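import Summits.QuantumFields.YangMills.Theorems.FemtoTransferGapSlabGround
import Summits.QuantumFields.YangMills.Theorems.LuscherReductionOneSiteLevelsPhysClass
import Literature.MathematicalPhysics.QuantumFieldTheory.LatticeGaugeUniformTorusAreaLawProofs
import HarnessLib

/-!
# Slab currency, fixed-lattice support III: centre twists commute with the Wilson flow; the flowed Polyakov lift of a
# one-site physical function is physical

Support module for route `LuscherReduction` (QuantumFields ∕ YangMills; rung leaf R2b1 `FemtoGapOfRecord`), crux `RunningReduction`
(stmt-QuantumFields-19978), owner input №3 «slab currency» (planner ym-beyond-p1 g15): the targets `wilsonFlow_twist` and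
`isPhys_flowLift` of `Sketch-RED-slab.lean` (plus the single-base-point variant `isPhys_flowLiftAt`).  Fleet service by seat ym-infvol-p2.

* §1 `plaquetteLoopSum_twist_of_mem_center` — Lüscher's staple sum `Ω_{x,μ}` is invariant under a central twist (every loop in it is a
  plaquette or a conjugated plaquette; `plaquetteHolonomy_twist_of_mem_center`); `wilsonFlowVF_twist` — for `SU(2)` (centre `{±1}`, tree
  `coe_eq_one_or_neg_one_of_mem_center`) the flow vector field is twist-covariant; **`wilsonFlow_twist`** — by uniqueness of flow lines
  (`IsWilsonFlowLine.eq_wilsonFlow`), exactly as the tree's `wilsonFlow_gaugeTransform`.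
* §2 Polyakov holonomies: `continuous_polyakovSite`, `polyakovSite_gaugeTransform` (a closed line is conjugated at its base point, so the
  one-site configuration of Polyakov holonomies is gauge-transformed by the constant `g(x)`), `polyakovSite_twist` (a line in direction
  `μ ≠ k` meets no twisted link, the line in direction `k` meets exactly one: tree `UniformTorusAreaLaw.lineHolonomy_ttwist_eq_mul`).
* §3 **`isPhys_flowLiftAt`**, **`isPhys_flowLift`** — the flowed Polyakov lift of a one-site physical test function is a physical test
  function of the fine theory (measurable by `measurable_wilsonFlow`, bounded, gauge invariant by `wilsonFlow_gaugeTransform`, zero-flux by §1).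

HONEST FRAMING: femto-universe infrastructure at fixed lattice; no renormalisation-group content; nothing here bears on infinite volume or the
Clay gap.  References: M. Lüscher, JHEP 1008:071 (2010) §1–§2 [cite: Luscher2010]; G. 't Hooft, NPB 153 (1979); M. Lüscher, NPB 219 (1983).
-/

set_option autoImplicit false

noncomputable section

open MeasureTheory Filter Topology Real
open scoped Matrix.Norms.Frobenius
open Literature.MathematicalPhysics.QuantumFieldTheory
open Literature.MathematicalPhysics.QuantumFieldTheory.WilsonFlow
open Literature.MathematicalPhysics.QuantumLattice
open Literature.Analysis.OperatorTheory.YMMatrixModel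

namespace Summit.QuantumFields.YangMills.Theorems.FemtoTransferGap

/-! ### §1. Centre twists commute with the Wilson flow -/

section Twist

variable {L : ℕ}

/-- `(c a)⁻¹ P (c a) = a⁻¹ P a` for central `c`. [folklore] -/
theorem center_mul_inv_mul_mul {G : Type*} [Group G] {c : G} (hc : c ∈ Subgroup.center G) (a P : G) :
    (c * a)⁻¹ * P * (c * a) = a⁻¹ * P * a := by
  have h : ∀ g : G, g * c = c * g := fun g => Subgroup.mem_center_iff.1 hc g
  rw [mul_inv_rev]
  calc a⁻¹ * c⁻¹ * P * (c * a) = a⁻¹ * c⁻¹ * (P * c) * a := by simp only [mul_assoc]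
    _ = a⁻¹ * c⁻¹ * (c * P) * a := by rw [h P]
    _ = a⁻¹ * P * a := by simp only [mul_assoc, inv_mul_cancel_left]

/-- **Lüscher's staple sum `Ω_{x,μ}` is invariant under a central twist** (each summand is a plaquette holonomy or a plaquette holonomy
conjugated by a link; both are twist invariant for a central twist). [cite: Luscher2010, eq. (1.4)] -/
theorem plaquetteLoopSum_twist_of_mem_center {n : ℕ} (k : Fin 3) {z : Matrix.specialUnitaryGroup (Fin n) ℂ}
    (hz : z ∈ Subgroup.center (Matrix.specialUnitaryGroup (Fin n) ℂ)) (V : GaugeConfig 3 L (Matrix.specialUnitaryGroup (Fin n) ℂ))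
    (x : Site 3 L) (μ : Fin 3) : plaquetteLoopSum (twist k z V) x μ = plaquetteLoopSum V x μ := by
  unfold plaquetteLoopSum
  refine Finset.sum_congr rfl fun ν _ => ?_
  split_ifs with h
  · rfl
  · rw [plaquetteHolonomy_twist_of_mem_center k hz V x (Ne.symm h), plaquetteHolonomy_twist_of_mem_center k hz V _ h]
    congr 2
    rw [twist_apply_eq_ite_mul]
    refine center_mul_inv_mul_mul ?_ _ _
    split_ifs
    exacts [hz, Subgroup.one_mem _]

/-- The twist factor of a link as an `SU(2)` matrix: `±1`, hence central in the matrix ring. [folklore] -/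
theorem twistFactor_mul_comm (k : Fin 3) {z : SU2} (hz : z ∈ Subgroup.center SU2) (e : Edge 3 L) (M : Matrix (Fin 2) (Fin 2) ℂ) :
    ((if e.2 = k ∧ e.1 k = 0 then z else 1 : SU2) : Matrix (Fin 2) (Fin 2) ℂ) * M =
      M * ((if e.2 = k ∧ e.1 k = 0 then z else 1 : SU2) : Matrix (Fin 2) (Fin 2) ℂ) := by
  split_ifs
  · rcases coe_eq_one_or_neg_one_of_mem_center hz with h | h <;> rw [h] <;> simp
  · simp

/-- **The `SU(2)` flow vector field is twist covariant**: `Z(twist V)(e) = c_e · Z(V)(e)` with `c_e ∈ {z, 1}` the twist factor of `e`.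
[cite: Luscher2010, §2.1] -/
theorem wilsonFlowVF_twist (k : Fin 3) {z : SU2} (hz : z ∈ Subgroup.center SU2) (V : GaugeConfig 3 L SU2) (e : Edge 3 L) :
    wilsonFlowVF (twist k z V) e =
      ((if e.2 = k ∧ e.1 k = 0 then z else 1 : SU2) : Matrix (Fin 2) (Fin 2) ℂ) * wilsonFlowVF V e := by
  have hΩ := plaquetteLoopSum_twist_of_mem_center k hz V e.1 e.2
  simp only [wilsonFlowVF, hΩ, twist_apply_eq_ite_mul, coe_mul_SU]
  rw [← Matrix.mul_assoc, ← twistFactor_mul_comm k hz e, Matrix.mul_assoc]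

variable [NeZero L]

/-- **Centre twists commute with the Wilson flow** (`SU(2)`): `V_t(twist U) = twist (V_t U)` — the twisted flow line solves the flow
equation (`wilsonFlowVF_twist`), so it is THE flow line (`IsWilsonFlowLine.eq_wilsonFlow`). [cite: Luscher2010, §2.1] -/
theorem wilsonFlow_twist (t : ℝ) (k : Fin 3) {z : SU2} (hz : z ∈ Subgroup.center SU2) (U : GaugeConfig 3 L SU2) :
    wilsonFlow t (twist k z U) = twist k z (wilsonFlow t U) := by
  have h : IsWilsonFlowLine (twist k z U) (fun t => twist k z (wilsonFlow t U)) := by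
    refine ⟨by simp only [wilsonFlow_zero], fun t e i j => ?_⟩
    have hW : HasDerivAt (fun s => ((wilsonFlow s U e : SU2) : Matrix (Fin 2) (Fin 2) ℂ))
        (wilsonFlowVF (wilsonFlow t U) e) t :=
      hasDerivAt_of_entries fun i j => hasDerivAt_wilsonFlow U t e i j
    have h2 := hW.const_mul ((if e.2 = k ∧ e.1 k = 0 then z else 1 : SU2) : Matrix (Fin 2) (Fin 2) ℂ)
    rw [← wilsonFlowVF_twist k hz] at h2
    have hfun : (fun s => ((twist k z (wilsonFlow s U) e : SU2) : Matrix (Fin 2) (Fin 2) ℂ) i j) =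
        fun s => (((if e.2 = k ∧ e.1 k = 0 then z else 1 : SU2) : Matrix (Fin 2) (Fin 2) ℂ) *
          ((wilsonFlow s U e : SU2) : Matrix (Fin 2) (Fin 2) ℂ)) i j := by
      funext s
      rw [twist_apply_eq_ite_mul, coe_mul_SU]
    beta_reduce
    rw [hfun]
    exact hasDerivAt_entry h2 i j
  exact (h.eq_wilsonFlow t).symm

end Twist

/-! ### §2. Polyakov holonomies read as a one-site configuration -/

section Polyakov

variable {L : ℕ}

/-- A straight-line holonomy is a continuous function of the configuration (finite product of link variables). [folklore] -/
theorem continuous_lineHolonomy_apply {G : Type*} [Group G] [TopologicalSpace G] [IsTopologicalGroup G] (k : Fin 3) :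
    ∀ (m : ℕ) (y : Site 3 L), Continuous fun U : GaugeConfig 3 L G => lineHolonomy U k m y
  | 0, y => by simpa [lineHolonomy] using continuous_const
  | m + 1, y => by
    simp only [lineHolonomy]
    exact (continuous_apply _).mul (continuous_lineHolonomy_apply k m (y.shift k))

/-- `U ↦ polyakovSite x U` is continuous. [folklore] -/
theorem continuous_polyakovSite {G : Type*} [Group G] [TopologicalSpace G] [IsTopologicalGroup G] (x : Site 3 L) :
    Continuous fun U : GaugeConfig 3 L G => polyakovSite x U :=
  continuous_pi fun e => continuous_lineHolonomy_apply e.2 L x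

/-- An open line is gauge-transformed at its endpoints: `P_m(U^g, y) = g(y) P_m(U, y) g(y + m e_k)⁻¹`. [folklore] -/
theorem lineHolonomy_gaugeTransform {G : Type*} [Group G] (g : Site 3 L → G) (U : GaugeConfig 3 L G) (k : Fin 3) :
    ∀ (m : ℕ) (y : Site 3 L), lineHolonomy (gaugeTransform g U) k m y =
      g y * lineHolonomy U k m y * (g (y + Pi.single k ((m : ℕ) : ZMod L)))⁻¹
  | 0, y => by simp [lineHolonomy]
  | m + 1, y => by
    rw [lineHolonomy, lineHolonomy, lineHolonomy_gaugeTransform g U k m (y.shift k), UniformTorusAreaLaw.shift_add_single]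
    simp only [gaugeTransform]
    group

/-- **The Polyakov holonomies at `x` of a gauge-transformed field are simultaneously conjugated by `g(x)`**, i.e. gauge-transformed by
the constant `g(x)` as a one-site configuration. [folklore] -/
theorem polyakovSite_gaugeTransform {G : Type*} [Group G] [NeZero L] (g : Site 3 L → G) (U : GaugeConfig 3 L G) (x : Site 3 L) :
    polyakovSite x (gaugeTransform g U) = gaugeTransform (fun _ => g x) (polyakovSite x U) := by
  funext e
  simp only [polyakovSite, gaugeTransform]
  rw [lineHolonomy_gaugeTransform, ZMod.natCast_self, Pi.single_zero, add_zero]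

/-- **The Polyakov holonomies at `x` of a centre-twisted field**: the one in direction `k` is multiplied by `z`, the others are
unchanged — i.e. the one-site configuration is twisted. [cite: tHooft1979] -/
theorem polyakovSite_twist {G : Type*} [Group G] [NeZero L] (k : Fin 3) {z : G} (hz : z ∈ Subgroup.center G)
    (U : GaugeConfig 3 L G) (x : Site 3 L) : polyakovSite x (twist k z U) = twist k z (polyakovSite x U) := by
  have hc : ∀ g : G, g * z = z * g := fun g => Subgroup.mem_center_iff.1 hz g
  have htw : twist k z U = UniformTorusAreaLaw.ttwist (fun e : Edge 3 L => e.2 = k ∧ e.1 k = 0) z U := rfl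
  funext e
  have he0 : e.1 k = 0 := Subsingleton.elim _ _
  simp only [polyakovSite, twist, he0, and_true]
  rw [htw]
  by_cases hμ : e.2 = k
  · rw [if_pos hμ, hμ]
    -- the line in direction `k` through `x` meets exactly one twisted link, at step `b = (−x_k).val`
    refine UniformTorusAreaLaw.lineHolonomy_ttwist_eq_mul hc k L x (-(x k)).val (ZMod.val_lt _) (fun t ht => ?_) U
    simp only [true_and, Pi.add_apply, Pi.single_eq_same]
    constructor
    · intro h
      have h' : ((t : ℕ) : ZMod L) = -x k := eq_neg_of_add_eq_zero_right h
      rw [← h', ZMod.val_natCast_of_lt ht]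
    · rintro rfl
      rw [ZMod.natCast_zmod_val, add_neg_cancel]
  · rw [if_neg hμ]
    exact UniformTorusAreaLaw.lineHolonomy_ttwist_of_forall_not e.2 L x (fun t _ h => hμ h.1) U

end Polyakov

/-! ### §3. The flowed Polyakov lift of a one-site physical function is physical -/

section FlowLift

variable {L : ℕ} [NeZero L]

/-- **`flowLiftAt x₀ t f` is physical** for a one-site physical `f`: measurable (`measurable_wilsonFlow`, continuity of the Polyakov
holonomies), bounded (as `f`), gauge invariant (`wilsonFlow_gaugeTransform` + `polyakovSite_gaugeTransform` + one-site gauge invariance of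
`f`) and zero-flux (`wilsonFlow_twist` + `polyakovSite_twist` + one-site twist invariance of `f`). [cite: Luscher2010, §2.1] -/
theorem isPhys_flowLiftAt (x₀ : Site 3 L) (t : ℝ) {f : GaugeConfig 3 1 SU2 → ℝ} (hf : IsPhys f) :
    IsPhys (flowLiftAt (L := L) x₀ t f) := by
  haveI : SecondCountableTopology SU2 := secondCountableTopology_su2
  obtain ⟨C, hC⟩ := hf.bounded
  refine ⟨?_, ⟨C, fun U => hC _⟩, fun g U => ?_, fun k z hz U => ?_⟩
  · exact hf.measurable.comp ((continuous_polyakovSite x₀).measurable.comp (measurable_wilsonFlow t))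
  · simp only [flowLiftAt, wilsonFlow_gaugeTransform, polyakovSite_gaugeTransform, hf.gaugeInv]
  · simp only [flowLiftAt, wilsonFlow_twist t k hz, polyakovSite_twist k hz, hf.zeroFlux k z hz]

/-- **`flowLift t f` (the site average of the flowed Polyakov lifts) is physical** for a one-site physical `f`. [cite: Luscher2010, §2.1] -/
theorem isPhys_flowLift (t : ℝ) {f : GaugeConfig 3 1 SU2 → ℝ} (hf : IsPhys f) : IsPhys (flowLift (L := L) t f) := by
  obtain ⟨C, hC⟩ := hf.bounded
  have hx := fun x : Site 3 L => isPhys_flowLiftAt x t hf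
  refine ⟨?_, ?_, fun g U => ?_, fun k z hz U => ?_⟩
  · exact (Finset.measurable_sum _ fun x _ => (hx x).measurable).div_const _
  · refine ⟨(∑ _x : Site 3 L, C) / (Fintype.card (Site 3 L) : ℝ), fun U => ?_⟩
    unfold flowLift
    rw [abs_div, Nat.abs_cast]
    exact div_le_div_of_nonneg_right ((Finset.abs_sum_le_sum_abs _ _).trans (Finset.sum_le_sum fun x _ => hC _))
      (Nat.cast_nonneg _)
  · unfold flowLift
    simp only [(hx _).gaugeInv g U]
  · unfold flowLift
    simp only [(hx _).zeroFlux k z hz U]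

end FlowLift

end Summit.QuantumFields.YangMills.Theorems.FemtoTransferGap

end
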